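import Summits.QuantumFields.YangMills.Theorems.MirrorModularBoostsHypercubicLimitPeelDecayDefs
import Summits.QuantumFields.YangMills.Theorems.PencilRigidityWeakCouplingHypercubicLimitCurvFunctional
import HarnessLib

/-!
# Crux `HypercubicLimit` (stmt-QuantumFields-16154), line `peel-and-disseminate`: (R3b) the RP-adapted pairings as slab-functional integrals

Support file (c3 seat, `--supports stmt-QuantumFields-16154`, registered sub-goal `rpFam_pair_eq_integral`)
for the registered piece (R3b) `stub_decayOfSlabClustering` of the reflection leg (R) of the line (main file
`MirrorModularBoostsHypercubicLimitPeelDecayOfSlabClustering.lean`; vocabulary `rpPoint`, `rpLat` in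
`MirrorModularBoostsHypercubicLimitPeelDecayDefs.lean`).  The RP-spectral slab clustering of `GapData` (iii)
speaks about bounded measurable real functionals `Y` of a time slab of `ℤ⁴` read through the periodic lift;
this file identifies the three pairings of the RP-adapted family `rpFam` of a scheme entering the connected OS
form with such integrals of the RP-adapted lattice functional `C_F = rpLat r L a m F`, and supplies the support
bookkeeping of `C_F`.

* §1 identities (exact, every torus): `rpFam_pair_eq_integral` — `rpFam (n+m) (ΘF* ⊗ G) =
  ∫ λ^{n+m} conj (C_F (lift ΘU)) C_G (lift U) dμ` (`rp_term_eq_integral` + the corner-reflection reindexing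
  `rp_sum_osAdjoint` of the host RP block); `rpFam_eq_integral` — `rpFam n F = ∫ λⁿ C_F (lift U) dμ`;
  `rpFam_osAdjoint` — EXACT hermiticity `rpFam n (ΘF*) = conj (rpFam n F)` for EVERY `F` (the host block
  `rpBlock_hermitian` re-run without time-ordering, `rpBlock_conj_osAdjoint`); `conj_rpLat` — `C_F` is real for
  real `F`; `rpLat_configShift` — NO WRAP-AROUND: `C_F (τ_{-s e₀} V) = C_{T_{(s a) e₀} F} (V)` as soon as every
  string seen by `F` stays in the corner ranges together with its translate (`rpPoint_sub_single`).
* §2 support: `rp_string_support` (a string seen by a test function supported in the closed `ρ`-ball at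
  positive times has corner times `≥ 1` — `rp_corner_pos` — and corner coordinates of modulus `≤ ρ/a + 2` —
  `norm_rpShift_le`), `rp_mem_rpDom` (such corners and their translates by `s e₀` lie in the corner ranges once
  `ρ/a + 2 + s ≤ L`), `measurable_rpLat`, `norm_rpLat_le` (`‖C_F‖ ≤ (Cₚ + C_m)ⁿ Σ‖F(centres)‖`),
  `rp_sum_norm_le` (`Σ‖F(centres)‖ ≤ (2B+3)^{4n} |F|_{0,0}`), `rpLat_dependsOn_slab` (slab dependence
  `{1 ≤ t, t + [μ=0] ≤ T}` via `plane_congr_of_slab`).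

Refs: OsterwalderSeiler1978 §§2–3 (lattice RP, transfer matrix); GlimmJaffe1987 §6.1, §19.7;
`PencilRigidityHypercubicLimitRpBlockReflectionPositive.lean`, `PencilRigidityHypercubicLimitRpBlockHermitian.lean`.
-/

set_option autoImplicit false
noncomputable section
open scoped SchwartzMap ENNReal ComplexConjugate
open MeasureTheory Filter Topology
open Literature.MathematicalPhysics.AQFT Literature.MathematicalPhysics.QuantumLattice
open Literature.MathematicalPhysics.QuantumFieldTheory
open Literature.Probability.LatticeModels (box Site)
open Summit.QuantumFields.YangMills.Cruxes.HypercubicLimit.ConditionalMeanTelescoping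
open Summit.QuantumFields.YangMills.Cruxes.OSLegsFromFemtoAndGap.DlrCollarTransfer (plane)
open Summit.QuantumFields.YangMills.Theorems.HypercubicLimit.Negative (torusPlaquette thetaZ)

namespace Summit.QuantumFields.YangMills.Cruxes.HypercubicLimit.PeelAndDisseminate

variable {G : Type} [Group G] [TopologicalSpace G] [IsTopologicalGroup G] [CompactSpace G]
  [MeasurableSpace G] [BorelSpace G]

/-! ## §1 The three pairings as integrals; exact hermiticity; realness; no wrap-around -/

/-- **The reflection pairing of the RP-adapted family is a reflection integral of the lattice functionals**
(registered sub-goal of this file): `rpFam (n+m) (ΘF* ⊗ G) = ∫ λ^{n+m} conj (C_F (lift ΘU)) · C_G (lift U) dμ` —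
the `(n+m)`-string sum splits along `Fin.append` (`rp_term_eq_integral`) and the corner-reflection reindexing
turns the functional of `ΘF*` into the conjugate of the functional of `F` at the reflected configuration
(`rp_sum_osAdjoint` with `herm_corner_mem/inv`, `herm_point_reflect`, `herm_torusPlaquette_corner`). -/
theorem rpFam_pair_eq_integral :
    ∀ {G : Type} [Group G] [TopologicalSpace G] [IsTopologicalGroup G] [CompactSpace G] [MeasurableSpace G]
      [BorelSpace G] (r : LatticeRep G) (β : ℝ) (L : ℕ) (a lam : ℝ) {n m : ℕ}
      (F : 𝓢((Fin n → EuclideanSpace ℝ (Fin 4)), ℂ)) (G' : 𝓢((Fin m → EuclideanSpace ℝ (Fin 4)), ℂ)),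
      rpFam r β L a lam (n + m) ((osAdjoint F).appendTensor G') =
        ∫ U, ((lam ^ (n + m) : ℝ) : ℂ) *
          conj (rpLat r L a (fun q => wilsonTorusMean r.ρ β L (planeObs r q.1)) F
            (torusLift (2 * L + 1) (GaugeConfig.timeReflect U))) *
          rpLat r L a (fun q => wilsonTorusMean r.ρ β L (planeObs r q.1)) G' (torusLift (2 * L + 1) U)
          ∂(wilsonMeasure r.ρ β : Measure (GaugeConfig 4 (2 * L + 1) G)) := by
  intro G _ _ _ _ _ _ r β L a lam n m F G'
  haveI := isProbabilityMeasure_wilsonMeasure (d := 4) (L := 2 * L + 1) r.ρ r.continuous β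
  have hTm : ∀ (q : {q : Fin 4 × Fin 4 // q.1 < q.2}) (y : Fin 4 → ℤ),
      Measurable (fun U : GaugeConfig 4 (2 * L + 1) G =>
        torusPlaquette r (2 * L + 1) q.1.1 q.1.2 y U - wilsonTorusMean r.ρ β L (planeObs r q.1)) :=
    fun q y => (Theorems.HypercubicLimit.Negative.measurable_torusPlaquette r _ _ _ y).sub measurable_const
  have hTb : ∀ (q : {q : Fin 4 × Fin 4 // q.1 < q.2}) (y : Fin 4 → ℤ), ∃ C, ∀ U : GaugeConfig 4 (2 * L + 1) G,
      |torusPlaquette r (2 * L + 1) q.1.1 q.1.2 y U - wilsonTorusMean r.ρ β L (planeObs r q.1)| ≤ C :=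
    fun q y => ⟨r.N + |wilsonTorusMean r.ρ β L (planeObs r q.1)|, fun U =>
      (abs_sub _ _).trans (add_le_add (abs_plaquetteObs_le_holds (ρ := r.ρ) r.mem_unitary y q.1.1
        q.1.2 (torusLift (2 * L + 1) U)) le_rfl)⟩
  rw [rpFam_apply']
  simp only [SchwartzMap.appendTensor_apply, Function.comp_def]
  refine (rp_term_eq_integral (wilsonMeasure r.ρ β : Measure (GaugeConfig 4 (2 * L + 1) G))
    (fun q => rpDom L q)
    (fun q y U => torusPlaquette r (2 * L + 1) q.1.1 q.1.2 y U - wilsonTorusMean r.ρ β L (planeObs r q.1))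
    hTm hTb (fun q y => rpPoint a q y) (lam ^ (n + m)) (osAdjoint F) G').trans ?_
  refine integral_congr_ae (ae_of_all _ fun U => ?_)
  dsimp only
  rw [rp_sum_osAdjoint (fun q => rpDom L q) (fun q y => if q.1.1 = 0 then thetaZ y - Pi.single 0 1 else thetaZ y)
    (fun q y hy => herm_corner_mem L q y hy) herm_corner_inv (fun q y => rpPoint a q y)
    (herm_point_reflect a)
    (fun q y U => torusPlaquette r (2 * L + 1) q.1.1 q.1.2 y U - wilsonTorusMean r.ρ β L (planeObs r q.1))
    GaugeConfig.timeReflect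
    (fun q y U => congrArg (· - wilsonTorusMean r.ρ β L (planeObs r q.1))
      (herm_torusPlaquette_corner r _ q y U).symm) F U]
  rw [rpLat_torusLift, rpLat_torusLift, mul_assoc]


/-- **The mean of the RP-adapted family is the integral of the lattice functional**:
`rpFam n F = ∫ λⁿ C_F (lift U) dμ`. -/
theorem rpFam_eq_integral (r : LatticeRep G) (β : ℝ) (L : ℕ) (a lam : ℝ) {n : ℕ}
    (F : 𝓢((Fin n → EuclideanSpace ℝ (Fin 4)), ℂ)) :
    rpFam r β L a lam n F =
      ∫ U, ((lam ^ n : ℝ) : ℂ) *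
        rpLat r L a (fun q => wilsonTorusMean r.ρ β L (planeObs r q.1)) F (torusLift (2 * L + 1) U)
        ∂(wilsonMeasure r.ρ β : Measure (GaugeConfig 4 (2 * L + 1) G)) := by
  haveI := isProbabilityMeasure_wilsonMeasure (d := 4) (L := 2 * L + 1) r.ρ r.continuous β
  have hI : ∀ (q : Fin n → {q : Fin 4 × Fin 4 // q.1 < q.2}) (x : Fin n → (Fin 4 → ℤ)),
      Integrable (fun U : GaugeConfig 4 (2 * L + 1) G =>
        ((∏ k, (torusPlaquette r (2 * L + 1) (q k).1.1 (q k).1.2 (x k) U -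
          wilsonTorusMean r.ρ β L (planeObs r (q k).1)) : ℝ) : ℂ))
        (wilsonMeasure r.ρ β : Measure (GaugeConfig 4 (2 * L + 1) G)) := fun q x => by
    refine Integrable.of_bound (Complex.measurable_ofReal.comp
      (Finset.measurable_prod _ fun k _ =>
        (Theorems.HypercubicLimit.Negative.measurable_torusPlaquette r _ _ _ (x k)).sub
          measurable_const)).aestronglyMeasurable
      (∏ k, ((r.N : ℝ) + |wilsonTorusMean r.ρ β L (planeObs r (q k).1)|)) (ae_of_all _ fun U => ?_)
    rw [Complex.norm_real, Real.norm_eq_abs, Finset.abs_prod]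
    exact Finset.prod_le_prod (fun k _ => abs_nonneg _) fun k _ =>
      (abs_sub _ _).trans (add_le_add (abs_plaquetteObs_le_holds (ρ := r.ρ) r.mem_unitary (x k)
        (q k).1.1 (q k).1.2 (torusLift (2 * L + 1) U)) le_rfl)
  have hterm : ∀ (q : Fin n → {q : Fin 4 × Fin 4 // q.1 < q.2}) (x : Fin n → (Fin 4 → ℤ)) (w : ℂ),
      (((lam ^ n * ∫ U, ∏ k, (torusPlaquette r (2 * L + 1) (q k).1.1 (q k).1.2 (x k) U -
            wilsonTorusMean r.ρ β L (planeObs r (q k).1))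
          ∂(wilsonMeasure r.ρ β : Measure (GaugeConfig 4 (2 * L + 1) G)) : ℝ) : ℂ)) * w =
        ∫ U, ((lam ^ n : ℝ) : ℂ) * (w * ((∏ k, (torusPlaquette r (2 * L + 1) (q k).1.1 (q k).1.2 (x k) U -
            wilsonTorusMean r.ρ β L (planeObs r (q k).1)) : ℝ) : ℂ))
          ∂(wilsonMeasure r.ρ β : Measure (GaugeConfig 4 (2 * L + 1) G)) := fun q x w => by
    rw [integral_const_mul, integral_const_mul, integral_complex_ofReal]; push_cast; ring
  rw [rpFam_apply']
  simp_rw [hterm, rpLat_torusLift, Finset.mul_sum]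
  rw [integral_finsetSum _ fun q _ => integrable_finsetSum _ fun x _ => ((hI q x).const_mul _).const_mul _]
  refine Finset.sum_congr rfl fun q _ => ?_
  rw [integral_finsetSum _ fun x _ => ((hI q x).const_mul _).const_mul _]

-- adapted from `rpBlock_hermitian` (its proof never uses the time-ordering hypothesis)
/-- **Exact lattice hermiticity of the RP-adapted block family for EVERY test function** (the proof of the
host block `rpBlock_hermitian` never uses time-ordering): `S n F = conj (S n (ΘF*))`. -/
theorem rpBlock_conj_osAdjoint (r : LatticeRep G) (β : ℝ) (L : ℕ) (a lam : ℝ)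
    (m : {q : Fin 4 × Fin 4 // q.1 < q.2} → ℝ) (n : ℕ) (F : 𝓢((Fin n → EuclideanSpace ℝ (Fin 4)), ℂ)) :
    ((fun n => ∑ q : Fin n → {q : Fin 4 × Fin 4 // q.1 < q.2},
        ∑ x ∈ Fintype.piFinset (fun k => if (q k).1.1 = 0 then box 4 L
            else (box 4 L).filter (fun y => 1 - (L : ℤ) ≤ y 0)),
          (((lam ^ n * ∫ U, ∏ k, (torusPlaquette r (2 * L + 1) (q k).1.1 (q k).1.2 (x k) U - m (q k))
              ∂(wilsonMeasure r.ρ β : Measure (GaugeConfig 4 (2 * L + 1) G)) : ℝ) : ℂ)) •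
            LabelledSchwingerFamily.evalAt (fun k => a • (siteToE (x k) +
              (2⁻¹ : ℝ) • (EuclideanSpace.single (q k).1.1 (1 : ℝ) + EuclideanSpace.single (q k).1.2 (1 : ℝ)
                - EuclideanSpace.single 0 (1 : ℝ))))) :
      SchwingerFamily (EuclideanSpace ℝ (Fin 4))) n F =
    conj (((fun n => ∑ q : Fin n → {q : Fin 4 × Fin 4 // q.1 < q.2},
        ∑ x ∈ Fintype.piFinset (fun k => if (q k).1.1 = 0 then box 4 L
            else (box 4 L).filter (fun y => 1 - (L : ℤ) ≤ y 0)),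
          (((lam ^ n * ∫ U, ∏ k, (torusPlaquette r (2 * L + 1) (q k).1.1 (q k).1.2 (x k) U - m (q k))
              ∂(wilsonMeasure r.ρ β : Measure (GaugeConfig 4 (2 * L + 1) G)) : ℝ) : ℂ)) •
            LabelledSchwingerFamily.evalAt (fun k => a • (siteToE (x k) +
              (2⁻¹ : ℝ) • (EuclideanSpace.single (q k).1.1 (1 : ℝ) + EuclideanSpace.single (q k).1.2 (1 : ℝ)
                - EuclideanSpace.single 0 (1 : ℝ))))) :
      SchwingerFamily (EuclideanSpace ℝ (Fin 4))) n (osAdjoint F)) := by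
  simp only [_root_.sum_apply, _root_.smul_apply, LabelledSchwingerFamily.evalAt_apply, osAdjoint_apply,
    map_sum, smul_eq_mul, map_mul, Complex.conj_conj, Complex.conj_ofReal]
  symm
  rw [herm_reindex L]
  refine Finset.sum_congr rfl fun q _ => Finset.sum_congr rfl fun x _ => ?_
  simp only [Function.comp_apply, Fin.rev_rev, herm_point_reflect, herm_weight]

/-- **Exact lattice hermiticity of the RP-adapted family of a scheme for every test function**:
`rpFam n (ΘF*) = conj (rpFam n F)`. -/
theorem rpFam_osAdjoint (r : LatticeRep G) (β : ℝ) (L : ℕ) (a lam : ℝ) (n : ℕ)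
    (F : 𝓢((Fin n → EuclideanSpace ℝ (Fin 4)), ℂ)) :
    rpFam r β L a lam n (osAdjoint F) = conj (rpFam r β L a lam n F) := by
  have h := rpBlock_conj_osAdjoint r β L a lam (fun q => wilsonTorusMean r.ρ β L (planeObs r q.1)) n F
  rw [← Complex.conj_conj (rpFam r β L a lam n (osAdjoint F))]
  exact congrArg conj h.symm

omit [IsTopologicalGroup G] [CompactSpace G] [BorelSpace G] in
/-- The RP-adapted functional of a REAL test function is real. -/
theorem conj_rpLat (r : LatticeRep G) (L : ℕ) (a : ℝ) (m : {q : Fin 4 × Fin 4 // q.1 < q.2} → ℝ) {n : ℕ}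
    {F : 𝓢((Fin n → EuclideanSpace ℝ (Fin 4)), ℂ)} (hF : ∀ u, conj (F u) = F u) (V : LGConfig 4 G) :
    conj (rpLat r L a m F V) = rpLat r L a m F V := by
  unfold rpLat
  simp only [map_sum, map_mul, Complex.conj_ofReal, hF]

omit [IsTopologicalGroup G] [CompactSpace G] [MeasurableSpace G] [BorelSpace G] in
/-- Translating an RP-adapted centre back by `(s a) e₀` is the centre at the corner `y − s e₀`. -/
theorem rpPoint_sub_single (a : ℝ) (q : {q : Fin 4 × Fin 4 // q.1 < q.2}) (s : ℕ) (y : Fin 4 → ℤ) :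
    rpPoint a q y - ((s : ℝ) * a) • EuclideanSpace.single (0 : Fin 4) (1 : ℝ) =
      rpPoint a q (y - Pi.single 0 (s : ℤ)) := by
  simp only [rpPoint, smul_add]
  rw [← Theorems.WeakCouplingHypercubicLimit.TraceNormColdPressure.smul_siteToE_sub_single]
  abel

omit [IsTopologicalGroup G] [CompactSpace G] [BorelSpace G] in
-- adapted from `curvFunctional_configShift` (corner ranges `rpDom` and RP centres in place of the box and sites)
/-- **No wrap-around**: translating the configuration by `s` lattice steps up in time inside the RP-adapted
functional equals evaluating it on the time-translated test function `T_{(s a) e₀} F`, provided every string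
seen by `F` stays in the corner ranges together with its translate. -/
theorem rpLat_configShift (r : LatticeRep G) (L : ℕ) (a : ℝ) (m : {q : Fin 4 × Fin 4 // q.1 < q.2} → ℝ)
    {n : ℕ} (s : ℕ) (F : 𝓢((Fin n → EuclideanSpace ℝ (Fin 4)), ℂ))
    (hF : ∀ (q : Fin n → {q : Fin 4 × Fin 4 // q.1 < q.2}) (x : Fin n → (Fin 4 → ℤ)),
      F (fun k => rpPoint a (q k) (x k)) ≠ 0 →
        ∀ l, x l ∈ rpDom L (q l) ∧ x l + Pi.single 0 (s : ℤ) ∈ rpDom L (q l))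
    (V : LGConfig 4 G) :
    rpLat r L a m F (configShift (-Pi.single 0 (s : ℤ)) V) =
      rpLat r L a m (translateMulti (((s : ℝ) * a) • EuclideanSpace.single (0 : Fin 4) (1 : ℝ)) F) V := by
  unfold rpLat
  refine Finset.sum_congr rfl fun q _ => ?_
  have htr : ∀ y : Fin n → (Fin 4 → ℤ),
      (fun l => rpPoint a (q l) (y l) - ((s : ℝ) * a) • EuclideanSpace.single (0 : Fin 4) (1 : ℝ)) =
        fun l => rpPoint a (q l) (y l - Pi.single 0 (s : ℤ)) :=
    fun y => funext fun l => rpPoint_sub_single a (q l) s (y l)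
  simp_rw [Theorems.WeakCouplingHypercubicLimit.TraceNormColdPressure.plane_configShift,
    translateMulti_apply, htr]
  refine Finset.sum_bij_ne_zero (fun y _ _ => fun l => y l + Pi.single 0 (s : ℤ)) (fun y _ hne => ?_)
    (fun y₁ _ _ y₂ _ _ h => funext fun l => add_right_cancel (congrFun h l)) (fun y' _ hne => ?_)
    (fun y _ _ => by simp only [add_sub_cancel_right])
  · have hF0 : F (fun l => rpPoint a (q l) (y l)) ≠ 0 := fun h => hne (by rw [h, zero_mul])
    exact Fintype.mem_piFinset.2 fun l => (hF q y hF0 l).2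
  · have hF0 : F (fun l => rpPoint a (q l) (y' l - Pi.single 0 (s : ℤ))) ≠ 0 :=
      fun h => hne (by rw [h, zero_mul])
    exact ⟨fun l => y' l - Pi.single 0 (s : ℤ), Fintype.mem_piFinset.2 fun l => (hF _ _ hF0 l).1,
      by simpa only [sub_add_cancel] using hne, funext fun l => sub_add_cancel _ _⟩

/-! ## §2 Support, measurability, bounds and slab dependence of the RP-adapted functional -/

omit [IsTopologicalGroup G] [CompactSpace G] [MeasurableSpace G] [BorelSpace G] in
/-- Spatial localisation of a corner by its centre: `‖centre‖ ≤ ρ` forces `|y i| ≤ ρ/a + 2`. -/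
theorem rp_corner_abs_le {a ρ : ℝ} (ha : 0 < a) (q : {q : Fin 4 × Fin 4 // q.1 < q.2}) (y : Fin 4 → ℤ)
    (h : ‖rpPoint a q y‖ ≤ ρ) (i : Fin 4) : |((y i : ℤ) : ℝ)| ≤ ρ / a + 2 := by
  have h1 : ‖a • siteToE y‖ ≤ ρ + 2 * a := by
    have h3 : a • siteToE y = rpPoint a q y - rpShift a q := by rw [rpPoint_eq, add_sub_cancel_right]
    rw [h3]
    exact (norm_sub_le _ _).trans (add_le_add h (norm_rpShift_le ha.le q))
  rw [norm_smul, Real.norm_of_nonneg ha.le] at h1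
  have h2 : |((y i : ℤ) : ℝ)| ≤ ‖siteToE y‖ := by
    have h3 : ‖siteToE y i‖ ≤ ‖siteToE y‖ := PiLp.norm_apply_le (siteToE y) i
    rwa [siteToE_apply, Real.norm_eq_abs] at h3
  rw [div_add' _ _ _ ha.ne', le_div_iff₀ ha]
  nlinarith [abs_nonneg ((y i : ℤ) : ℝ)]

omit [IsTopologicalGroup G] [CompactSpace G] [MeasurableSpace G] [BorelSpace G] in
/-- **String support**: a string seen by a test function supported in the closed `ρ`-ball at positive times
has every corner time `≥ 1` and every corner coordinate of modulus `≤ ρ/a + 2`. -/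
theorem rp_string_support {a ρ : ℝ} (ha : 0 < a) {n : ℕ} {F : 𝓢((Fin n → EuclideanSpace ℝ (Fin 4)), ℂ)}
    (hFρ : tsupport (F : (Fin n → EuclideanSpace ℝ (Fin 4)) → ℂ) ⊆ Metric.closedBall 0 ρ)
    (hFp : tsupport (F : (Fin n → EuclideanSpace ℝ (Fin 4)) → ℂ) ⊆ {u | ∀ l, 0 < u l 0})
    (q : Fin n → {q : Fin 4 × Fin 4 // q.1 < q.2}) (x : Fin n → (Fin 4 → ℤ))
    (h0 : F (fun k => rpPoint a (q k) (x k)) ≠ 0) (l : Fin n) :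
    1 ≤ x l 0 ∧ ∀ i, |((x l i : ℤ) : ℝ)| ≤ ρ / a + 2 := by
  have hmem : (fun k => rpPoint a (q k) (x k)) ∈ tsupport (F : (Fin n → EuclideanSpace ℝ (Fin 4)) → ℂ) :=
    subset_tsupport _ (Function.mem_support.2 h0)
  refine ⟨rp_corner_pos ha (q l) (x l) ((hFp hmem) l), fun i => rp_corner_abs_le ha (q l) (x l) ?_ i⟩
  have h := hFρ hmem
  rw [Metric.mem_closedBall, dist_zero_right] at h
  exact (norm_le_pi_norm (fun k => rpPoint a (q k) (x k)) l).trans h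

omit [IsTopologicalGroup G] [CompactSpace G] [MeasurableSpace G] [BorelSpace G] in
/-- A corner with time `≥ 1` and coordinates of modulus `≤ B` lies, together with its translate by `s e₀`,
in every corner range of the torus of half-side `L ≥ B + s`. -/
theorem rp_mem_rpDom {L s : ℕ} {y : Fin 4 → ℤ} {B : ℝ} (h1 : 1 ≤ y 0) (hB : ∀ i, |((y i : ℤ) : ℝ)| ≤ B)
    (hL : B + s ≤ L) (q : {q : Fin 4 × Fin 4 // q.1 < q.2}) :
    y ∈ rpDom L q ∧ y + Pi.single 0 (s : ℤ) ∈ rpDom L q := by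
  have hs : (0 : ℝ) ≤ s := Nat.cast_nonneg _
  have hyi : ∀ i, -(L : ℤ) ≤ y i ∧ y i ≤ L := fun i => by
    have h : |((y i : ℤ) : ℝ)| ≤ L := by linarith [hB i]
    have h' : |y i| ≤ (L : ℤ) := by exact_mod_cast h
    exact abs_le.1 h'
  have hy0 : y 0 + (s : ℤ) ≤ L := by
    have h : ((y 0 : ℤ) : ℝ) + s ≤ L := by linarith [hB 0, le_abs_self ((y 0 : ℤ) : ℝ)]
    exact_mod_cast h
  have hmem : ∀ z : Fin 4 → ℤ, (∀ i, -(L : ℤ) ≤ z i ∧ z i ≤ L) → 1 ≤ z 0 → z ∈ rpDom L q := by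
    intro z hz hz0
    unfold rpDom
    split_ifs
    · exact Literature.Probability.LatticeModels.mem_box.2 hz
    · exact Finset.mem_filter.2 ⟨Literature.Probability.LatticeModels.mem_box.2 hz, by omega⟩
  refine ⟨hmem y hyi h1, hmem _ (fun i => ?_) ?_⟩
  · by_cases hi : i = 0
    · subst hi
      simp only [Pi.add_apply, Pi.single_eq_same]
      constructor <;> omega
    · simp only [Pi.add_apply, Pi.single_eq_of_ne hi, add_zero]
      exact hyi i
  · simp only [Pi.add_apply, Pi.single_eq_same]
    omega

/-- The RP-adapted functional is measurable. -/
theorem measurable_rpLat (r : LatticeRep G) (L : ℕ) (a : ℝ) (m : {q : Fin 4 × Fin 4 // q.1 < q.2} → ℝ)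
    {n : ℕ} (F : 𝓢((Fin n → EuclideanSpace ℝ (Fin 4)), ℂ)) : Measurable (rpLat r L a m F) := by
  unfold rpLat
  refine Finset.measurable_sum _ fun q _ => Finset.measurable_sum _ fun x _ => ?_
  exact (Complex.measurable_ofReal.comp (Finset.measurable_prod _ fun l _ =>
    (Theorems.WeakCouplingHypercubicLimit.TraceNormColdPressure.measurable_plane r _ (x l)).sub
      measurable_const)).const_mul _

omit [IsTopologicalGroup G] [CompactSpace G] [BorelSpace G] in
/-- **Sup bound** of the RP-adapted functional: `‖C_F V‖ ≤ (Cₚ + C_m)ⁿ Σ_q Σ_{x ∈ D_q} ‖F(centres)‖`. -/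
theorem norm_rpLat_le (r : LatticeRep G) (L : ℕ) (a : ℝ) {m : {q : Fin 4 × Fin 4 // q.1 < q.2} → ℝ}
    {n : ℕ} (F : 𝓢((Fin n → EuclideanSpace ℝ (Fin 4)), ℂ)) {Cp Cm : ℝ}
    (hCp : ∀ (p : Fin 4 × Fin 4) (x : Fin 4 → ℤ) (U : LGConfig 4 G), |plane G r p x U| ≤ Cp)
    (hCm : ∀ q, |m q| ≤ Cm) (V : LGConfig 4 G) :
    ‖rpLat r L a m F V‖ ≤ (Cp + Cm) ^ n * ∑ q : Fin n → {q : Fin 4 × Fin 4 // q.1 < q.2},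
      ∑ x ∈ Fintype.piFinset (fun k => rpDom L (q k)), ‖F (fun k => rpPoint a (q k) (x k))‖ := by
  unfold rpLat
  rw [Finset.mul_sum]
  refine (norm_sum_le _ _).trans (Finset.sum_le_sum fun q _ => ?_)
  rw [Finset.mul_sum]
  refine (norm_sum_le _ _).trans (Finset.sum_le_sum fun x _ => ?_)
  rw [norm_mul, Complex.norm_real, Real.norm_eq_abs, mul_comm, Finset.abs_prod]
  refine mul_le_mul_of_nonneg_right ?_ (norm_nonneg _)
  calc ∏ l, |plane G r (q l).1 (x l) V - m (q l)| ≤ ∏ _l : Fin n, (Cp + Cm) :=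
        Finset.prod_le_prod (fun _ _ => abs_nonneg _) fun l _ =>
          (abs_sub _ _).trans (add_le_add (hCp _ _ _) (hCm _))
    _ = (Cp + Cm) ^ n := by simp

omit [IsTopologicalGroup G] [CompactSpace G] [MeasurableSpace G] [BorelSpace G] in
-- adapted from `thermal_bookkeeping_sum_le` (RP centres in place of scaled sites)
/-- **Counting the strings seen by a compactly supported test function**: if `F(centres) ≠ 0` forces all corner
coordinates to have modulus `≤ B` (`0 ≤ B`), then `Σ_{x ∈ D_q} ‖F(centres)‖ ≤ (2B + 3)^{4n} |F|_{0,0}`. -/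
theorem rp_sum_norm_le {L : ℕ} {a B : ℝ} (hB : 0 ≤ B) {n : ℕ} (F : 𝓢((Fin n → EuclideanSpace ℝ (Fin 4)), ℂ))
    (q : Fin n → {q : Fin 4 × Fin 4 // q.1 < q.2})
    (hF : ∀ x : Fin n → (Fin 4 → ℤ), F (fun k => rpPoint a (q k) (x k)) ≠ 0 → ∀ l i, |((x l i : ℤ) : ℝ)| ≤ B) :
    ∑ x ∈ Fintype.piFinset (fun k => rpDom L (q k)), ‖F (fun k => rpPoint a (q k) (x k))‖ ≤
      (2 * B + 3) ^ (4 * n) * SchwartzMap.seminorm ℂ 0 0 F := by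
  classical
  set S : Finset (Fin n → (Fin 4 → ℤ)) := Fintype.piFinset fun _ : Fin n => box 4 ⌊B⌋₊ with hS
  set g : (Fin n → (Fin 4 → ℤ)) → ℝ := fun y => ‖F (fun k => rpPoint a (q k) (y k))‖ with hg
  have hg0 : ∀ y, 0 ≤ g y := fun y => norm_nonneg _
  have hmemS : ∀ y, g y ≠ 0 → y ∈ S := by
    intro y hy
    have hF0 : F (fun k => rpPoint a (q k) (y k)) ≠ 0 := fun h => hy (by simp [hg, h])
    rw [hS, Fintype.mem_piFinset]
    intro l
    rw [Literature.Probability.LatticeModels.mem_box]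
    intro i
    have h1 : |((y l i : ℤ) : ℝ)| ≤ B := hF y hF0 l i
    have h2 : ((y l i).natAbs : ℝ) ≤ B := by rwa [Nat.cast_natAbs, Int.cast_abs]
    have h3 : (y l i).natAbs ≤ ⌊B⌋₊ := Nat.le_floor h2
    omega
  calc ∑ y ∈ Fintype.piFinset (fun k => rpDom L (q k)), g y
      = ∑ y ∈ (Fintype.piFinset (fun k => rpDom L (q k))).filter (fun y => g y ≠ 0), g y :=
        (Finset.sum_filter_ne_zero _).symm
    _ ≤ ∑ y ∈ S, g y :=
        Finset.sum_le_sum_of_subset_of_nonneg (fun y hy => hmemS y (Finset.mem_filter.1 hy).2)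
          (fun y _ _ => hg0 y)
    _ ≤ S.card • SchwartzMap.seminorm ℂ 0 0 F :=
        Finset.sum_le_card_nsmul _ _ _ (fun y _ => SchwartzMap.norm_le_seminorm ℂ F _)
    _ = (2 * (⌊B⌋₊ : ℝ) + 1) ^ (4 * n) * SchwartzMap.seminorm ℂ 0 0 F := by
        rw [nsmul_eq_mul, hS, Fintype.card_piFinset_const, Literature.Probability.LatticeModels.card_box,
          ← pow_mul]
        push_cast
        ring
    _ ≤ (2 * B + 3) ^ (4 * n) * SchwartzMap.seminorm ℂ 0 0 F := by
        have hfl : (⌊B⌋₊ : ℝ) ≤ B := Nat.floor_le hB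
        have h0 : 0 ≤ SchwartzMap.seminorm ℂ 0 0 F := apply_nonneg _ _
        have hle : 2 * (⌊B⌋₊ : ℝ) + 1 ≤ 2 * B + 3 := by linarith
        gcongr

omit [IsTopologicalGroup G] [CompactSpace G] [BorelSpace G] in
-- adapted from `curvFunctional_facts` (slab support)
/-- **Slab dependence**: if `F(centres) ≠ 0` forces every corner time into `[1, T − 1]`, the RP-adapted functional
depends only on the links of the time slab `1 ≤ t`, `t + [μ = 0] ≤ T`. -/
theorem rpLat_dependsOn_slab (r : LatticeRep G) (L : ℕ) (a : ℝ) (m : {q : Fin 4 × Fin 4 // q.1 < q.2} → ℝ)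
    {n : ℕ} (F : 𝓢((Fin n → EuclideanSpace ℝ (Fin 4)), ℂ)) {T : ℕ}
    (hF : ∀ (q : Fin n → {q : Fin 4 × Fin 4 // q.1 < q.2}) (x : Fin n → (Fin 4 → ℤ)),
      F (fun k => rpPoint a (q k) (x k)) ≠ 0 → ∀ l, 1 ≤ x l 0 ∧ x l 0 + 1 ≤ T) :
    DependsOn (rpLat r L a m F) {e : Literature.MathematicalPhysics.QuantumLattice.ZdEdge 4 |
      1 ≤ e.1 0 ∧ e.1 0 + (if e.2 = 0 then 1 else 0) ≤ T} := by
  intro U V hUV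
  unfold rpLat
  refine Finset.sum_congr rfl fun q _ => Finset.sum_congr rfl fun x _ => ?_
  by_cases h0 : F (fun k => rpPoint a (q k) (x k)) = 0
  · rw [h0, zero_mul, zero_mul]
  · congr 2
    exact Finset.prod_congr rfl fun l _ => by
      rw [Theorems.WeakCouplingHypercubicLimit.TraceNormColdPressure.plane_congr_of_slab r (q l).2
        (hF q x h0 l).1 (hF q x h0 l).2 hUV]

end Summit.QuantumFields.YangMills.Cruxes.HypercubicLimit.PeelAndDisseminate

end
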